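import Summits.NavierStokesRegularity.NavierStokesRegularity.Theorems.EulerZoomLiouvillePowerGaugeEulerLiouvilleProfileEnergyTools

/-!
# Profile local energy equality, II: the pointwise algebra of the limit passage, the `L^{3/2}` weight, the limit
# (crux `EulerZoomLiouville.PowerGaugeEulerLiouville` = stmt-NavierStokesRegularity-19832, line `birth`, rung C1)

Route `EulerZoomLiouville` (NavierStokesRegularity).  At mollification level `n` the tested identity has the
integrand `Iₙ(x)` (data `v = V x`, `w = Wₙ x`, `D = DWₙ x`, `d = Dσ x`, `s = σ x`, `p = P x`); the limit integrand
is `I_∞(x) = ½ d(v)|v|² + p d(v) + (γ/2) d(x)|v|² + (5γ/2 − 1) s|v|²`.  Here: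
* `integrandN_sub_integrandLim` — `Iₙ − I_∞` is LINEAR in `w − v` (pure inner-product algebra);
* `abs_integrandN_sub_integrandLim_le` — `|Iₙ − I_∞| ≤ Ψ·‖w − v‖` with an explicit weight `Ψ`;
* `eLpNorm_weight_le` — `‖Ψₙ‖_{3/2} ≤ M` uniformly (Minkowski + Hölder + Young's contraction);
* `integral_eq_zero_of_limit` — `∫Iₙ = 0`, `|Iₙ − J| ≤ Ψₙ‖gₙ‖`, `‖Ψₙ‖_{3/2} ≤ M`, `‖gₙ‖₃ → 0` ⇒ `∫ J = 0`.

Context.  An EXACTLY SELF-SIMILAR member `u(t,x) = (−t)^{γ−1} V(x/(−t)^γ)`, `p = (−t)^{2(γ−1)} P(x/(−t)^γ)`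
(`γ = 1/(2+ρ)`) of Seregin's power-gauged ancient Euler class (the crux, stmt-NavierStokesRegularity-19832) has an
`H¹_loc` profile (`E`-gauge) with `P ∈ L^{3/2}_loc` (`D`-gauge) solving the profile equation
`(1−γ)V + γ(y·∇)V + (V·∇)V + ∇P = 0` weakly.  The lineage's profile dictionary transfers the local energy
INEQUALITY only (`selfSimilar_profile_energy_le_add_flux`); critic-2's K3 (the NSI cascade) shows the open core of
the crux needs a lever that USES THE EULER IDENTITY.  This chain of files supplies the first such lever on rung C1:
velocity-testing the weak profile equation (legitimate for `H¹_loc` profiles because the equation is steady-type: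
`H¹_loc ⊂ L⁶_loc` closes the trilinear term; Chae–Shvydkoy 2013 §2.2 ASSUME `C¹_loc` for the local energy equality)
gives the profile LOCAL ENERGY EQUALITY `(2 − 5γ)∫σ|V|² = ∫(|V|²+2P)⟪V,∇σ⟫ + γ∫|V|²⟪y,∇σ⟫`.
WHAT THIS IS NOT: not NS regularity, not the crux — a C1 tool, `--supports` stmt-19832. [folklore]
-/

noncomputable section

set_option linter.dupNamespace false

open MeasureTheory Set Filter Topology Metric Function TopologicalSpace
open scoped ENNReal NNReal RealInnerProductSpace ContDiff Convolution

namespace Summit.NavierStokesRegularity.NavierStokesRegularity.Theorems.PowerGaugeEulerLiouville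

open Literature.Analysis Literature.Analysis.FunctionSpaces Literature.Analysis.FluidPDE

namespace ProfileEnergy

/-! ## The pointwise algebra of the limit passage -/

section Pointwise

/-- **The difference of the two integrands is linear in `w − v`.** [folklore] -/
theorem integrandN_sub_integrandLim (γ : ℝ) (x v w : EuclideanSpace ℝ (Fin 3))
    (D : EuclideanSpace ℝ (Fin 3) →L[ℝ] EuclideanSpace ℝ (Fin 3)) (d : EuclideanSpace ℝ (Fin 3) →L[ℝ] ℝ)
    (s p : ℝ) :
    (d v * ⟪v, w⟫ + s * ⟪v, D v⟫ + p * d w +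
          γ * (d x * ⟪v, w⟫ + s * ⟪v, D x⟫) + (4 * γ - 1) * (s * ⟪v, w⟫) -
          ((1 / 2 : ℝ) * (d v * ‖w‖ ^ 2) + s * ⟪w, D v⟫) -
          γ * ((1 / 2 : ℝ) * (d x * ‖w‖ ^ 2) + s * ⟪w, D x⟫ + 3 * ((1 / 2 : ℝ) * (s * ‖w‖ ^ 2)))) - ((1 / 2 : ℝ) * (d v * ‖v‖ ^ 2) + p * d v + γ * ((1 / 2 : ℝ) * (d x * ‖v‖ ^ 2)) +
          (5 / 2 * γ - 1) * (s * ‖v‖ ^ 2)) =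
      d v * ⟪v, w - v⟫ - (1 / 2 : ℝ) * (d v * ⟪w - v, w + v⟫) + s * ⟪v - w, D v⟫ + p * d (w - v) +
        γ * (d x * ⟪v, w - v⟫) - γ / 2 * (d x * ⟪w - v, w + v⟫) + γ * (s * ⟪v - w, D x⟫) +
        (4 * γ - 1) * (s * ⟪v, w - v⟫) - 3 / 2 * γ * (s * ⟪w - v, w + v⟫) := by
  simp only [map_sub, inner_sub_left, inner_sub_right, inner_add_right,
    ← real_inner_self_eq_norm_sq, real_inner_comm w v]
  ring

/-- **Pointwise bound**: `|Iₙ − I_∞| ≤ Ψ · ‖w − v‖` with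
`Ψ = (3/2)C'‖v‖² + (C'/2)‖v‖‖w‖ + C‖D‖‖v‖ + C'|p| + a₅‖v‖ + a₆‖w‖ + |γ| C R ‖D‖`
(`‖d‖ ≤ C'`, `|s| ≤ C`, `‖x‖ ≤ R`). [folklore] -/
theorem abs_integrandN_sub_integrandLim_le {γ : ℝ} {x v w : EuclideanSpace ℝ (Fin 3)}
    {D : EuclideanSpace ℝ (Fin 3) →L[ℝ] EuclideanSpace ℝ (Fin 3)} {d : EuclideanSpace ℝ (Fin 3) →L[ℝ] ℝ}
    {s p C C' R : ℝ} (hd : ‖d‖ ≤ C') (hs : |s| ≤ C) (hx : ‖x‖ ≤ R) (hC : 0 ≤ C) (hC' : 0 ≤ C')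
    (hR : 0 ≤ R) :
    |(d v * ⟪v, w⟫ + s * ⟪v, D v⟫ + p * d w +
          γ * (d x * ⟪v, w⟫ + s * ⟪v, D x⟫) + (4 * γ - 1) * (s * ⟪v, w⟫) -
          ((1 / 2 : ℝ) * (d v * ‖w‖ ^ 2) + s * ⟪w, D v⟫) -
          γ * ((1 / 2 : ℝ) * (d x * ‖w‖ ^ 2) + s * ⟪w, D x⟫ + 3 * ((1 / 2 : ℝ) * (s * ‖w‖ ^ 2)))) - ((1 / 2 : ℝ) * (d v * ‖v‖ ^ 2) + p * d v + γ * ((1 / 2 : ℝ) * (d x * ‖v‖ ^ 2)) +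
          (5 / 2 * γ - 1) * (s * ‖v‖ ^ 2))| ≤
      ((3 / 2 : ℝ) * C' * ‖v‖ ^ 2 + (1 / 2 : ℝ) * C' * (‖v‖ * ‖w‖) + C * (‖D‖ * ‖v‖) + C' * |p| +
          (3 / 2 * |γ| * C' * R + |4 * γ - 1| * C + 3 / 2 * |γ| * C) * ‖v‖ +
          (1 / 2 * |γ| * C' * R + 3 / 2 * |γ| * C) * ‖w‖ + |γ| * C * R * ‖D‖) *
        ‖w - v‖ := by
  rw [integrandN_sub_integrandLim]
  -- elementary bounds on the building blocks
  have hdv : ∀ u : EuclideanSpace ℝ (Fin 3), |d u| ≤ C' * ‖u‖ := fun u =>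
    (Real.norm_eq_abs _ ▸ d.le_opNorm u).trans (mul_le_mul_of_nonneg_right hd (norm_nonneg _))
  have hDv : ∀ u : EuclideanSpace ℝ (Fin 3), ‖D u‖ ≤ ‖D‖ * ‖u‖ := fun u => D.le_opNorm u
  have hin : ∀ a b : EuclideanSpace ℝ (Fin 3), |⟪a, b⟫| ≤ ‖a‖ * ‖b‖ := fun a b => abs_real_inner_le_norm a b
  have hwv : ‖w + v‖ ≤ ‖w‖ + ‖v‖ := norm_add_le w v
  have hvw' : ‖v - w‖ = ‖w - v‖ := norm_sub_rev v w
  set δ := ‖w - v‖ with hδ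
  have hδ0 : 0 ≤ δ := norm_nonneg _
  -- term by term
  have t1 : |d v * ⟪v, w - v⟫| ≤ C' * ‖v‖ ^ 2 * δ := by
    rw [abs_mul]
    calc |d v| * |⟪v, w - v⟫| ≤ (C' * ‖v‖) * (‖v‖ * δ) :=
          mul_le_mul (hdv v) (hin _ _) (abs_nonneg _) (by positivity)
      _ = C' * ‖v‖ ^ 2 * δ := by ring
  have t2 : |(1 / 2 : ℝ) * (d v * ⟪w - v, w + v⟫)| ≤ (1 / 2 : ℝ) * C' * ‖v‖ * (‖w‖ + ‖v‖) * δ := by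
    rw [abs_mul, abs_mul, abs_of_pos (by norm_num : (0 : ℝ) < 1 / 2)]
    have h1 : |⟪w - v, w + v⟫| ≤ δ * (‖w‖ + ‖v‖) :=
      (hin _ _).trans (mul_le_mul_of_nonneg_left hwv hδ0)
    calc (1 / 2 : ℝ) * (|d v| * |⟪w - v, w + v⟫|) ≤ (1 / 2 : ℝ) * ((C' * ‖v‖) * (δ * (‖w‖ + ‖v‖))) :=
          mul_le_mul_of_nonneg_left (mul_le_mul (hdv v) h1 (abs_nonneg _) (by positivity)) (by norm_num)
      _ = _ := by ring
  have t3 : |s * ⟪v - w, D v⟫| ≤ C * (‖D‖ * ‖v‖) * δ := by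
    rw [abs_mul]
    have h1 : |⟪v - w, D v⟫| ≤ ‖v - w‖ * (‖D‖ * ‖v‖) :=
      (hin _ _).trans (mul_le_mul_of_nonneg_left (hDv v) (norm_nonneg _))
    calc |s| * |⟪v - w, D v⟫| ≤ C * (‖v - w‖ * (‖D‖ * ‖v‖)) :=
          mul_le_mul hs h1 (abs_nonneg _) hC
      _ = C * (‖D‖ * ‖v‖) * δ := by rw [hvw']; ring
  have t4 : |p * d (w - v)| ≤ C' * |p| * δ := by
    rw [abs_mul]
    calc |p| * |d (w - v)| ≤ |p| * (C' * δ) := mul_le_mul_of_nonneg_left (hdv _) (abs_nonneg _)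
      _ = C' * |p| * δ := by ring
  have hdx : |d x| ≤ C' * R := (hdv x).trans (mul_le_mul_of_nonneg_left hx hC')
  have hDx : ‖D x‖ ≤ ‖D‖ * R := (hDv x).trans (mul_le_mul_of_nonneg_left hx (norm_nonneg _))
  have t5 : |γ * (d x * ⟪v, w - v⟫)| ≤ |γ| * C' * R * ‖v‖ * δ := by
    rw [abs_mul, abs_mul]
    calc |γ| * (|d x| * |⟪v, w - v⟫|) ≤ |γ| * ((C' * R) * (‖v‖ * δ)) :=
          mul_le_mul_of_nonneg_left (mul_le_mul hdx (hin _ _) (abs_nonneg _) (by positivity)) (abs_nonneg _)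
      _ = _ := by ring
  have t6 : |γ / 2 * (d x * ⟪w - v, w + v⟫)| ≤ 1 / 2 * |γ| * C' * R * (‖w‖ + ‖v‖) * δ := by
    rw [abs_mul, abs_mul, abs_div, abs_two]
    have h1 : |⟪w - v, w + v⟫| ≤ δ * (‖w‖ + ‖v‖) :=
      (hin _ _).trans (mul_le_mul_of_nonneg_left hwv hδ0)
    calc |γ| / 2 * (|d x| * |⟪w - v, w + v⟫|) ≤ |γ| / 2 * ((C' * R) * (δ * (‖w‖ + ‖v‖))) :=
          mul_le_mul_of_nonneg_left (mul_le_mul hdx h1 (abs_nonneg _) (by positivity)) (by positivity)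
      _ = _ := by ring
  have t7 : |γ * (s * ⟪v - w, D x⟫)| ≤ |γ| * C * R * ‖D‖ * δ := by
    rw [abs_mul, abs_mul]
    have h1 : |⟪v - w, D x⟫| ≤ ‖v - w‖ * (‖D‖ * R) :=
      (hin _ _).trans (mul_le_mul_of_nonneg_left hDx (norm_nonneg _))
    calc |γ| * (|s| * |⟪v - w, D x⟫|) ≤ |γ| * (C * (‖v - w‖ * (‖D‖ * R))) :=
          mul_le_mul_of_nonneg_left (mul_le_mul hs h1 (abs_nonneg _) hC) (abs_nonneg _)
      _ = _ := by rw [hvw']; ring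
  have t8 : |(4 * γ - 1) * (s * ⟪v, w - v⟫)| ≤ |4 * γ - 1| * C * ‖v‖ * δ := by
    rw [abs_mul, abs_mul]
    calc |4 * γ - 1| * (|s| * |⟪v, w - v⟫|) ≤ |4 * γ - 1| * (C * (‖v‖ * δ)) :=
          mul_le_mul_of_nonneg_left (mul_le_mul hs (hin _ _) (abs_nonneg _) hC) (abs_nonneg _)
      _ = _ := by ring
  have t9 : |3 / 2 * γ * (s * ⟪w - v, w + v⟫)| ≤ 3 / 2 * |γ| * C * (‖w‖ + ‖v‖) * δ := by
    rw [abs_mul, abs_mul, abs_mul, abs_div, abs_two, abs_of_pos (by norm_num : (0 : ℝ) < 3)]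
    have h1 : |⟪w - v, w + v⟫| ≤ δ * (‖w‖ + ‖v‖) :=
      (hin _ _).trans (mul_le_mul_of_nonneg_left hwv hδ0)
    calc 3 / 2 * |γ| * (|s| * |⟪w - v, w + v⟫|) ≤ 3 / 2 * |γ| * (C * (δ * (‖w‖ + ‖v‖))) :=
          mul_le_mul_of_nonneg_left (mul_le_mul hs h1 (abs_nonneg _) hC) (by positivity)
      _ = _ := by ring
  -- triangle inequality and sum
  set T1 := d v * ⟪v, w - v⟫
  set T2 := (1 / 2 : ℝ) * (d v * ⟪w - v, w + v⟫)
  set T3 := s * ⟪v - w, D v⟫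
  set T4 := p * d (w - v)
  set T5 := γ * (d x * ⟪v, w - v⟫)
  set T6 := γ / 2 * (d x * ⟪w - v, w + v⟫)
  set T7 := γ * (s * ⟪v - w, D x⟫)
  set T8 := (4 * γ - 1) * (s * ⟪v, w - v⟫)
  set T9 := 3 / 2 * γ * (s * ⟪w - v, w + v⟫)
  have c9 : |T1 - T2 + T3 + T4 + T5 - T6 + T7 + T8 - T9| ≤ |T1 - T2 + T3 + T4 + T5 - T6 + T7 + T8| + |T9| :=
    abs_sub _ _
  have c8 : |T1 - T2 + T3 + T4 + T5 - T6 + T7 + T8| ≤ |T1 - T2 + T3 + T4 + T5 - T6 + T7| + |T8| :=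
    abs_add_le _ _
  have c7 : |T1 - T2 + T3 + T4 + T5 - T6 + T7| ≤ |T1 - T2 + T3 + T4 + T5 - T6| + |T7| := abs_add_le _ _
  have c6 : |T1 - T2 + T3 + T4 + T5 - T6| ≤ |T1 - T2 + T3 + T4 + T5| + |T6| := abs_sub _ _
  have c5 : |T1 - T2 + T3 + T4 + T5| ≤ |T1 - T2 + T3 + T4| + |T5| := abs_add_le _ _
  have c4 : |T1 - T2 + T3 + T4| ≤ |T1 - T2 + T3| + |T4| := abs_add_le _ _
  have c3 : |T1 - T2 + T3| ≤ |T1 - T2| + |T3| := abs_add_le _ _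
  have c2 : |T1 - T2| ≤ |T1| + |T2| := abs_sub _ _
  have hsum : |T1 - T2 + T3 + T4 + T5 - T6 + T7 + T8 - T9| ≤
      C' * ‖v‖ ^ 2 * δ + (1 / 2 : ℝ) * C' * ‖v‖ * (‖w‖ + ‖v‖) * δ + C * (‖D‖ * ‖v‖) * δ + C' * |p| * δ +
        |γ| * C' * R * ‖v‖ * δ + 1 / 2 * |γ| * C' * R * (‖w‖ + ‖v‖) * δ + |γ| * C * R * ‖D‖ * δ +
        |4 * γ - 1| * C * ‖v‖ * δ + 3 / 2 * |γ| * C * (‖w‖ + ‖v‖) * δ := by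
    linarith
  refine hsum.trans (le_of_eq ?_)
  ring

end Pointwise

/-! ## The uniform `L^{3/2}` bound on the weight and the limit passage -/

section Limit

/-- **`L^{3/2}` bound of the weight `Ψ`** of the pointwise estimate (Minkowski + Hölder with exponents
`(3,3)`, `(2,6)`, and Young's contraction for the mollified field). [folklore] -/
theorem eLpNorm_weight_le {Vt W : EuclideanSpace ℝ (Fin 3) → EuclideanSpace ℝ (Fin 3)}
    {DWS Pt : EuclideanSpace ℝ (Fin 3) → ℝ} {S : Set (EuclideanSpace ℝ (Fin 3))} (hSm : MeasurableSet S)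
    (hVtm : AEStronglyMeasurable Vt volume) (hWm : AEStronglyMeasurable W volume)
    (hDWSm : AEStronglyMeasurable DWS volume) (hPtm : AEStronglyMeasurable Pt volume)
    (hDWS0 : ∀ x, x ∉ S → DWS x = 0) {NG : ℝ≥0∞} (hDWS2 : eLpNorm DWS 2 volume ≤ NG)
    (hW3 : eLpNorm W 3 volume ≤ eLpNorm Vt 3 volume)
    (hW32 : eLpNorm W (3 / 2 : ℝ≥0∞) volume ≤ eLpNorm Vt (3 / 2 : ℝ≥0∞) volume) (a1 a2 a3 a4 a5 a6 a7 : ℝ) :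
    eLpNorm (fun x => a1 * ‖Vt x‖ ^ 2 + a2 * (‖Vt x‖ * ‖W x‖) + a3 * (DWS x * ‖Vt x‖) + a4 * |Pt x| +
        a5 * ‖Vt x‖ + a6 * ‖W x‖ + a7 * DWS x) (3 / 2 : ℝ≥0∞) volume ≤
      ‖a1‖ₑ * eLpNorm Vt 3 volume ^ 2 + ‖a2‖ₑ * (eLpNorm Vt 3 volume * eLpNorm Vt 3 volume) +
        ‖a3‖ₑ * (NG * eLpNorm Vt 6 volume) + ‖a4‖ₑ * eLpNorm Pt (3 / 2 : ℝ≥0∞) volume +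
        ‖a5‖ₑ * eLpNorm Vt (3 / 2 : ℝ≥0∞) volume + ‖a6‖ₑ * eLpNorm Vt (3 / 2 : ℝ≥0∞) volume +
        ‖a7‖ₑ * (NG * eLpNorm (S.indicator fun _ : EuclideanSpace ℝ (Fin 3) => (1 : ℝ)) 6 volume) := by
  haveI := holderTriple_three_three_threeHalves
  haveI := holderTriple_two_six_threeHalves
  -- the seven summands
  set f1 : EuclideanSpace ℝ (Fin 3) → ℝ := fun x => a1 * ‖Vt x‖ ^ 2 with hf1
  set f2 : EuclideanSpace ℝ (Fin 3) → ℝ := fun x => a2 * (‖Vt x‖ * ‖W x‖) with hf2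
  set f3 : EuclideanSpace ℝ (Fin 3) → ℝ := fun x => a3 * (DWS x * ‖Vt x‖) with hf3
  set f4 : EuclideanSpace ℝ (Fin 3) → ℝ := fun x => a4 * |Pt x| with hf4
  set f5 : EuclideanSpace ℝ (Fin 3) → ℝ := fun x => a5 * ‖Vt x‖ with hf5
  set f6 : EuclideanSpace ℝ (Fin 3) → ℝ := fun x => a6 * ‖W x‖ with hf6
  set f7 : EuclideanSpace ℝ (Fin 3) → ℝ := fun x => a7 * DWS x with hf7
  have hm1 : AEStronglyMeasurable f1 volume := (hVtm.norm.pow 2).const_mul _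
  have hm2 : AEStronglyMeasurable f2 volume := (hVtm.norm.mul hWm.norm).const_mul _
  have hm3 : AEStronglyMeasurable f3 volume := (hDWSm.mul hVtm.norm).const_mul _
  have hm4 : AEStronglyMeasurable f4 volume := (continuous_abs.comp_aestronglyMeasurable hPtm).const_mul _
  have hm5 : AEStronglyMeasurable f5 volume := hVtm.norm.const_mul _
  have hm6 : AEStronglyMeasurable f6 volume := hWm.norm.const_mul _
  have hm7 : AEStronglyMeasurable f7 volume := hDWSm.const_mul _
  have heq : (fun x => a1 * ‖Vt x‖ ^ 2 + a2 * (‖Vt x‖ * ‖W x‖) + a3 * (DWS x * ‖Vt x‖) + a4 * |Pt x| +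
        a5 * ‖Vt x‖ + a6 * ‖W x‖ + a7 * DWS x) = f1 + f2 + f3 + f4 + f5 + f6 + f7 := by
    funext x; simp only [Pi.add_apply, hf1, hf2, hf3, hf4, hf5, hf6, hf7]
  rw [heq]
  have h32 : (1 : ℝ≥0∞) ≤ 3 / 2 :=
    (by rw [ENNReal.le_div_iff_mul_le (Or.inl (by norm_num)) (Or.inl (by norm_num))]; norm_num)
  -- the individual bounds
  have b1 : eLpNorm f1 (3 / 2 : ℝ≥0∞) volume = ‖a1‖ₑ * eLpNorm Vt 3 volume ^ 2 := by
    rw [hf1, eLpNorm_const_mul', eLpNorm_norm_sq_threeHalves]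
  have b2 : eLpNorm f2 (3 / 2 : ℝ≥0∞) volume ≤ ‖a2‖ₑ * (eLpNorm Vt 3 volume * eLpNorm Vt 3 volume) := by
    rw [hf2, eLpNorm_const_mul']
    gcongr
    calc eLpNorm (fun x => ‖Vt x‖ * ‖W x‖) (3 / 2 : ℝ≥0∞) volume
        ≤ eLpNorm (fun x => ‖Vt x‖) 3 volume * eLpNorm (fun x => ‖W x‖) 3 volume :=
          eLpNorm_mul_le_threeHalves hVtm.norm hWm.norm 3 3
      _ = eLpNorm Vt 3 volume * eLpNorm W 3 volume := by rw [eLpNorm_norm, eLpNorm_norm]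
      _ ≤ eLpNorm Vt 3 volume * eLpNorm Vt 3 volume := by gcongr
  have b3 : eLpNorm f3 (3 / 2 : ℝ≥0∞) volume ≤ ‖a3‖ₑ * (NG * eLpNorm Vt 6 volume) := by
    rw [hf3, eLpNorm_const_mul']
    gcongr
    calc eLpNorm (fun x => DWS x * ‖Vt x‖) (3 / 2 : ℝ≥0∞) volume
        ≤ eLpNorm DWS 2 volume * eLpNorm (fun x => ‖Vt x‖) 6 volume :=
          eLpNorm_mul_le_threeHalves hDWSm hVtm.norm 2 6
      _ = eLpNorm DWS 2 volume * eLpNorm Vt 6 volume := by rw [eLpNorm_norm]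
      _ ≤ NG * eLpNorm Vt 6 volume := by gcongr
  have b4 : eLpNorm f4 (3 / 2 : ℝ≥0∞) volume = ‖a4‖ₑ * eLpNorm Pt (3 / 2 : ℝ≥0∞) volume := by
    rw [hf4, eLpNorm_const_mul']
    congr 1
    have : (fun x => |Pt x|) = fun x => ‖Pt x‖ := funext fun x => (Real.norm_eq_abs _).symm
    rw [this, eLpNorm_norm]
  have b5 : eLpNorm f5 (3 / 2 : ℝ≥0∞) volume = ‖a5‖ₑ * eLpNorm Vt (3 / 2 : ℝ≥0∞) volume := by
    rw [hf5, eLpNorm_const_mul', eLpNorm_norm]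
  have b6 : eLpNorm f6 (3 / 2 : ℝ≥0∞) volume ≤ ‖a6‖ₑ * eLpNorm Vt (3 / 2 : ℝ≥0∞) volume := by
    rw [hf6, eLpNorm_const_mul', eLpNorm_norm]
    gcongr
  have b7 : eLpNorm f7 (3 / 2 : ℝ≥0∞) volume ≤
      ‖a7‖ₑ * (NG * eLpNorm (S.indicator fun _ : EuclideanSpace ℝ (Fin 3) => (1 : ℝ)) 6 volume) := by
    rw [hf7, eLpNorm_const_mul']
    gcongr
    have hprod : (fun x => DWS x) = fun x => DWS x * S.indicator (fun _ => (1 : ℝ)) x := by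
      funext x
      by_cases hx : x ∈ S
      · rw [indicator_of_mem hx, mul_one]
      · rw [hDWS0 x hx, zero_mul]
    calc eLpNorm DWS (3 / 2 : ℝ≥0∞) volume
        = eLpNorm (fun x => DWS x * S.indicator (fun _ => (1 : ℝ)) x) (3 / 2 : ℝ≥0∞) volume := by
          rw [← hprod]
      _ ≤ eLpNorm DWS 2 volume * eLpNorm (S.indicator fun _ => (1 : ℝ)) 6 volume :=
          eLpNorm_mul_le_threeHalves hDWSm ((aestronglyMeasurable_const).indicator hSm) 2 6
      _ ≤ NG * eLpNorm (S.indicator fun _ => (1 : ℝ)) 6 volume := by gcongr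
  -- Minkowski
  calc eLpNorm (f1 + f2 + f3 + f4 + f5 + f6 + f7) (3 / 2 : ℝ≥0∞) volume
      ≤ eLpNorm (f1 + f2 + f3 + f4 + f5 + f6) (3 / 2 : ℝ≥0∞) volume + eLpNorm f7 (3 / 2 : ℝ≥0∞) volume :=
        eLpNorm_add_le (((((hm1.add hm2).add hm3).add hm4).add hm5).add hm6) hm7 h32
    _ ≤ eLpNorm (f1 + f2 + f3 + f4 + f5) (3 / 2 : ℝ≥0∞) volume + eLpNorm f6 (3 / 2 : ℝ≥0∞) volume +
          eLpNorm f7 (3 / 2 : ℝ≥0∞) volume := by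
        gcongr; exact eLpNorm_add_le ((((hm1.add hm2).add hm3).add hm4).add hm5) hm6 h32
    _ ≤ eLpNorm (f1 + f2 + f3 + f4) (3 / 2 : ℝ≥0∞) volume + eLpNorm f5 (3 / 2 : ℝ≥0∞) volume +
          eLpNorm f6 (3 / 2 : ℝ≥0∞) volume + eLpNorm f7 (3 / 2 : ℝ≥0∞) volume := by
        gcongr; exact eLpNorm_add_le (((hm1.add hm2).add hm3).add hm4) hm5 h32
    _ ≤ eLpNorm (f1 + f2 + f3) (3 / 2 : ℝ≥0∞) volume + eLpNorm f4 (3 / 2 : ℝ≥0∞) volume +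
          eLpNorm f5 (3 / 2 : ℝ≥0∞) volume + eLpNorm f6 (3 / 2 : ℝ≥0∞) volume +
          eLpNorm f7 (3 / 2 : ℝ≥0∞) volume := by
        gcongr; exact eLpNorm_add_le ((hm1.add hm2).add hm3) hm4 h32
    _ ≤ eLpNorm (f1 + f2) (3 / 2 : ℝ≥0∞) volume + eLpNorm f3 (3 / 2 : ℝ≥0∞) volume +
          eLpNorm f4 (3 / 2 : ℝ≥0∞) volume + eLpNorm f5 (3 / 2 : ℝ≥0∞) volume +
          eLpNorm f6 (3 / 2 : ℝ≥0∞) volume + eLpNorm f7 (3 / 2 : ℝ≥0∞) volume := by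
        gcongr; exact eLpNorm_add_le (hm1.add hm2) hm3 h32
    _ ≤ eLpNorm f1 (3 / 2 : ℝ≥0∞) volume + eLpNorm f2 (3 / 2 : ℝ≥0∞) volume +
          eLpNorm f3 (3 / 2 : ℝ≥0∞) volume + eLpNorm f4 (3 / 2 : ℝ≥0∞) volume +
          eLpNorm f5 (3 / 2 : ℝ≥0∞) volume + eLpNorm f6 (3 / 2 : ℝ≥0∞) volume +
          eLpNorm f7 (3 / 2 : ℝ≥0∞) volume := by
        gcongr; exact eLpNorm_add_le hm1 hm2 h32
    _ ≤ _ := by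
        rw [b1, b4, b5]
        gcongr

/-- **The limit passage.**  If `∫ Iₙ = 0` with `Iₙ` integrable, `J` is integrable,
`|Iₙ − J| ≤ Ψₙ ‖gₙ‖` pointwise with `‖Ψₙ‖_{3/2} ≤ M < ∞`, and `‖gₙ‖₃ → 0`, then `∫ J = 0`. [folklore] -/
theorem integral_eq_zero_of_limit {I : ℕ → EuclideanSpace ℝ (Fin 3) → ℝ} {J : EuclideanSpace ℝ (Fin 3) → ℝ}
    {Ψ : ℕ → EuclideanSpace ℝ (Fin 3) → ℝ} {g : ℕ → EuclideanSpace ℝ (Fin 3) → EuclideanSpace ℝ (Fin 3)}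
    {M : ℝ≥0∞} (hI : ∀ᶠ n in atTop, Integrable (I n) volume ∧ ∫ x, I n x = 0) (hJ : Integrable J volume)
    (hΨm : ∀ n, AEStronglyMeasurable (Ψ n) volume) (hgm : ∀ n, AEStronglyMeasurable (g n) volume)
    (hΨ0 : ∀ n x, 0 ≤ Ψ n x) (hpt : ∀ᶠ n in atTop, ∀ x, |I n x - J x| ≤ Ψ n x * ‖g n x‖)
    (hΨM : ∀ᶠ n in atTop, eLpNorm (Ψ n) (3 / 2 : ℝ≥0∞) volume ≤ M) (hM : M ≠ ⊤)
    (hg : Tendsto (fun n => eLpNorm (g n) 3 volume) atTop (𝓝 0)) : ∫ x, J x = 0 := by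
  haveI : ENNReal.HolderTriple (3 / 2 : ℝ≥0∞) 3 1 := by
    refine ⟨?_⟩
    rw [ENNReal.inv_div (Or.inr (by norm_num)) (Or.inr (by norm_num)), inv_one]
    have e3 : (3 : ℝ≥0∞)⁻¹ = ((3⁻¹ : ℝ≥0) : ℝ≥0∞) := by rw [ENNReal.coe_inv (by norm_num)]; norm_num
    have e23 : (2 / 3 : ℝ≥0∞) = ((2 / 3 : ℝ≥0) : ℝ≥0∞) := by rw [ENNReal.coe_div (by norm_num)]; norm_num
    rw [e3, e23, ← ENNReal.coe_add, ← ENNReal.coe_one, ENNReal.coe_inj]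
    norm_num
  have hev : ∀ᶠ n in atTop, eLpNorm (g n) 3 volume < ⊤ :=
    ((tendsto_order.1 hg).2 ⊤ (by simp)).mono fun n hn => hn
  -- the bound `|∫ J| ≤ (M ‖gₙ‖₃).toReal` eventually
  have hbound : ∀ᶠ n in atTop, |∫ x, J x| ≤ (M * eLpNorm (g n) 3 volume).toReal := by
    filter_upwards [hI, hpt, hΨM, hev] with n hIn hptn hΨn hgn
    obtain ⟨hIi, hI0⟩ := hIn
    have h1 : ∫ x, J x = ∫ x, (J x - I n x) := by
      rw [integral_sub hJ hIi, hI0, sub_zero]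
    have h2 : |∫ x, (J x - I n x)| ≤ ∫ x, |J x - I n x| := abs_integral_le_integral_abs
    have h3 : ∫ x, |J x - I n x| = (∫⁻ x, ‖J x - I n x‖ₑ).toReal := by
      have hm : AEStronglyMeasurable (fun x => J x - I n x) volume := (hJ.sub hIi).aestronglyMeasurable
      have := integral_norm_eq_lintegral_enorm hm
      simp only [Real.norm_eq_abs] at this
      exact this
    have h4 : ∫⁻ x, ‖J x - I n x‖ₑ ≤ M * eLpNorm (g n) 3 volume := by
      calc ∫⁻ x, ‖J x - I n x‖ₑ ≤ ∫⁻ x, ‖(Ψ n • g n) x‖ₑ := by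
            refine lintegral_mono fun x => ?_
            rw [Pi.smul_apply', enorm_smul, ← ofReal_norm, ← ofReal_norm (Ψ n x),
              ← ofReal_norm (g n x), ← ENNReal.ofReal_mul (norm_nonneg _)]
            refine ENNReal.ofReal_le_ofReal ?_
            rw [Real.norm_eq_abs, Real.norm_eq_abs, abs_of_nonneg (hΨ0 n x), abs_sub_comm]
            exact hptn x
        _ = eLpNorm (Ψ n • g n) 1 volume := by rw [eLpNorm_one_eq_lintegral_enorm]
        _ ≤ eLpNorm (Ψ n) (3 / 2 : ℝ≥0∞) volume * eLpNorm (g n) 3 volume :=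
            eLpNorm_smul_le_mul_eLpNorm (hgm n) (hΨm n)
        _ ≤ M * eLpNorm (g n) 3 volume := by gcongr
    rw [h1]
    refine h2.trans ?_
    rw [h3]
    exact ENNReal.toReal_mono (ENNReal.mul_ne_top hM hgn.ne) h4
  -- the right-hand side tends to `0`
  have hlim : Tendsto (fun n => (M * eLpNorm (g n) 3 volume).toReal) atTop (𝓝 0) := by
    have h1 : Tendsto (fun n => M * eLpNorm (g n) 3 volume) atTop (𝓝 (M * 0)) :=
      ENNReal.Tendsto.const_mul hg (Or.inr hM)
    rw [mul_zero] at h1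
    have h2 := (ENNReal.tendsto_toReal ENNReal.zero_ne_top).comp h1
    rw [ENNReal.toReal_zero] at h2
    exact h2
  have h := le_of_tendsto_of_tendsto tendsto_const_nhds hlim hbound
  exact abs_nonpos_iff.1 h

end Limit


end ProfileEnergy

end Summit.NavierStokesRegularity.NavierStokesRegularity.Theorems.PowerGaugeEulerLiouville
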